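import Summits.Ventures.PercRepro.RankLevelSetFiveCircuitAvg

/-!
# PercRepro — THE AVERAGING RECURSION FOR THE 5-CIRCUITS CONTINUED: `s₅ ≤ 4671 / 6339 / 8452 / 11093` at nullity
`13 … 16` (p9, gen 29; S4 — the cells `13 ≤ d ≤ 16` of the rows `≤ 36` of the `q = 7` window)

p8 g6's `ncard_fiveCircuits_sub_div_le` (RankLevelSetFiveCircuitAvg: on an `e`-free core of nullity `d + 1 ≥ 7`,
`s₅ − ⌊5 s₅/(d + 6)⌋ ≤ s₅(d)`) continued from its value `3374` at nullity `12`: `4671` at `13`, `6339` at `14`, `8452` at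
`15`, `11093` at `16` — below the sharp polynomial `7d(d + 1)(d² + d + 10)/48 = 5096 / 6737 / 8750 / 11186` there; at
nullity `17` the polynomial (`14101`) beats the recursion (`14355`) and the continuation stops. Axioms: standard.
-/

open scoped Matroid

namespace PercRepro

namespace ThmN

open Set

variable {α : Type}

/-- **`s₅ ≤ 4671` on every core of nullity 13** (`s − ⌊5s/18⌋ ≤ 3374 ⟹ s ≤ 4671`). -/
theorem ncard_fiveCircuits_le_forty_six_seventy_one (M : Matroid α) [M.Finite]
    (hfree : ∀ e ∈ M.E, ∃ A ⊆ M.E \ {e}, e ∉ M.closure A ∧ e ∉ M.closure ((M.E \ {e}) \ A))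
    (hd : M.E.encard = M.eRank + 13) : {C : Set α | M.IsCircuit C ∧ C.ncard = 5}.ncard ≤ 4671 := by
  have h := ncard_fiveCircuits_sub_div_le M hfree (d := 12) hd (by norm_num)
    (fun M' _ hfree' hd' => ncard_fiveCircuits_le_thirty_three_seventy_four M' hfree' hd')
  omega

/-- **`s₅ ≤ 6339` on every core of nullity 14** (`s − ⌊5s/19⌋ ≤ 4671 ⟹ s ≤ 6339`). -/
theorem ncard_fiveCircuits_le_sixty_three_thirty_nine (M : Matroid α) [M.Finite]
    (hfree : ∀ e ∈ M.E, ∃ A ⊆ M.E \ {e}, e ∉ M.closure A ∧ e ∉ M.closure ((M.E \ {e}) \ A))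
    (hd : M.E.encard = M.eRank + 14) : {C : Set α | M.IsCircuit C ∧ C.ncard = 5}.ncard ≤ 6339 := by
  have h := ncard_fiveCircuits_sub_div_le M hfree (d := 13) hd (by norm_num)
    (fun M' _ hfree' hd' => ncard_fiveCircuits_le_forty_six_seventy_one M' hfree' hd')
  omega

/-- **`s₅ ≤ 8452` on every core of nullity 15** (`s − ⌊5s/20⌋ ≤ 6339 ⟹ s ≤ 8452`). -/
theorem ncard_fiveCircuits_le_eighty_four_fifty_two (M : Matroid α) [M.Finite]
    (hfree : ∀ e ∈ M.E, ∃ A ⊆ M.E \ {e}, e ∉ M.closure A ∧ e ∉ M.closure ((M.E \ {e}) \ A))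
    (hd : M.E.encard = M.eRank + 15) : {C : Set α | M.IsCircuit C ∧ C.ncard = 5}.ncard ≤ 8452 := by
  have h := ncard_fiveCircuits_sub_div_le M hfree (d := 14) hd (by norm_num)
    (fun M' _ hfree' hd' => ncard_fiveCircuits_le_sixty_three_thirty_nine M' hfree' hd')
  omega

/-- **`s₅ ≤ 11093` on every core of nullity 16** (`s − ⌊5s/21⌋ ≤ 8452 ⟹ s ≤ 11093`). -/
theorem ncard_fiveCircuits_le_eleven_thousand_ninety_three (M : Matroid α) [M.Finite]
    (hfree : ∀ e ∈ M.E, ∃ A ⊆ M.E \ {e}, e ∉ M.closure A ∧ e ∉ M.closure ((M.E \ {e}) \ A))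
    (hd : M.E.encard = M.eRank + 16) : {C : Set α | M.IsCircuit C ∧ C.ncard = 5}.ncard ≤ 11093 := by
  have h := ncard_fiveCircuits_sub_div_le M hfree (d := 15) hd (by norm_num)
    (fun M' _ hfree' hd' => ncard_fiveCircuits_le_eighty_four_fifty_two M' hfree' hd')
  omega

end ThmN

end PercRepro
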